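import Literature.Analysis.FluidPDE.ElgindiAngularRadialInterpolation
import Literature.Analysis.FluidPDE.ElgindiPolarSingularWeights
import HarnessLib

/-!
# The mixed derivative `α∂_θD_zΨ` in `𝓗⁴` by interpolation — the strip inequality
([Elgindi2021] §9.2.2 / [ElgindiGhoulMasmoudi2021] §2.3.1, §6 Theorem 3)

Topic `Literature/Analysis/FluidPDE`. Support file (one definition with body — the radial support
predicate `ZSupp` — and proved theorems, no named facts) on the proof path of the named fact
`Literature.Analysis.FluidPDE.Elgindi.ElgindiGhoulMasmoudi2021_stabilityCore`
(`ElgindiStabilityDecomposition.lean`). See `ElgindiAngularRadialInterpolation.lean` for the sources: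
Theorem 2 of Elgindi (arXiv:1904.04795, §7.5, p. 24) and Theorem 3 of Elgindi–Ghoul–Masmoudi
(arXiv:1910.14071, §6, p. 15) export `∂_θθΨ`, `αD_RΨ`, `α²D_R²Ψ` in `𝓗ᵏ`, while the velocity
`U(Ψ)/sin 2θ` of §9.2.2 (p. 32) needs `α∂_θD_RΨ` (through Proposition 8.21).

For `Ψ` smooth on `ℝ²` (`Smooth2`), vanishing on the sides `θ = 0, π/2` and for `z` outside a compact
subinterval of `(0, ∞)` (the a-priori class of the elliptic estimates), and `0 < α ≤ 1`:
* radial terms (`integral_strip_sq_dθ_Dz_le`): with `Z = D_z^{j+1}Ψ`,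
  `∫∫ w²(∂_θZ)²S^{−η} ≤ 199·(−∫∫ w²Z∂_θθZ S^{−η})` (the angular identity slice by slice) and
  `−∫∫ w²Z∂_θθZS^{−η} = ∫∫ [b(Z + D_zZ)w² + bZ·D_z(w²)]S^{−η}`, `b = ∂_θθD_zʲΨ` (the radial identity
  slice by slice, Fubini), whence by Cauchy–Schwarz
  `‖D_zʲ(α∂_θD_zΨ)‖² ≤ 600(‖D_zʲ∂_θθΨ‖² + ‖D_zʲ(αD_zΨ)‖² + ‖D_zʲ(α²D_z²Ψ)‖²)` (weights `w²S^{−η}`);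
* angular words: `D_θⁱD_zʲ(α∂_θD_zΨ) = αD_θ^{i−1}(sin 2θ·D_z^{j+1}∂_θθΨ)`, words of `sin 2θ·v`
  (`ElgindiAngularRadialInterpolation`);
* **the strip inequality** (`eHkNormSq_dθ_Dz_le`):
  `|α∂_θD_zΨ|²_{𝓗⁴} ≤ 10¹²·(|∂_θθΨ|²_{𝓗⁴} + |αD_zΨ|²_{𝓗⁴} + |α²D_z²Ψ|²_{𝓗⁴})` (`eHkNormSq α 4`).
[folklore] (weighted interpolation); the cites record its role.
-/

noncomputable section

open Set Real MeasureTheory Function Filter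
open _root_.Topology
open scoped ContDiff ENNReal

namespace Literature.Analysis.FluidPDE

namespace Elgindi

/-! ### Radial support -/

/-- **Radial support in `[z₁, z₂]`**: `u(z, θ) = 0` whenever `z < z₁` or `z₂ < z`. [folklore] -/
def ZSupp (z₁ z₂ : ℝ) (u : ℝ → ℝ → ℝ) : Prop := ∀ z, (z < z₁ ∨ z₂ < z) → ∀ θ, u z θ = 0

namespace ZSupp

variable {z₁ z₂ : ℝ} {u : ℝ → ℝ → ℝ}

/-- `D_z` preserves the radial support. [folklore] -/
theorem Dz (h : ZSupp z₁ z₂ u) : ZSupp z₁ z₂ (Dz u) := by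
  intro z hz θ
  have hev : (fun z' => u z' θ) =ᶠ[𝓝 z] fun _ => 0 := by
    rcases hz with hz | hz
    · exact Filter.eventuallyEq_of_mem (Iio_mem_nhds hz) fun y hy => h y (Or.inl hy) θ
    · exact Filter.eventuallyEq_of_mem (Ioi_mem_nhds hz) fun y hy => h y (Or.inr hy) θ
  simp only [Elgindi.Dz]
  rw [hev.deriv_eq, deriv_const, mul_zero]

/-- `∂_θ` preserves the radial support. [folklore] -/
theorem dθ (h : ZSupp z₁ z₂ u) : ZSupp z₁ z₂ (dθ u) := by
  intro z hz θ
  simp only [Elgindi.dθ]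
  rw [show (fun θ' => u z θ') = fun _ => (0:ℝ) from funext fun θ' => h z hz θ', deriv_const]

/-- `D_θ` preserves the radial support. [folklore] -/
theorem Dθ (h : ZSupp z₁ z₂ u) : ZSupp z₁ z₂ (Dθ u) := by
  intro z hz θ
  rw [Dθ_eq_mul_dθ, h.dθ z hz θ, mul_zero]

/-- The radial words keep the radial support. [folklore] -/
theorem iterate_Dz (h : ZSupp z₁ z₂ u) (j : ℕ) : ZSupp z₁ z₂ (Elgindi.Dz^[j] u) := by
  induction j with
  | zero => exact h
  | succ j ih => rw [Function.iterate_succ_apply']; exact ih.Dz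

/-- The mixed words keep the radial support. [folklore] -/
theorem iterate_Dθ (h : ZSupp z₁ z₂ u) (i : ℕ) : ZSupp z₁ z₂ (Elgindi.Dθ^[i] u) := by
  induction i with
  | zero => exact h
  | succ i ih => rw [Function.iterate_succ_apply']; exact ih.Dθ

/-- Scalar multiples keep the radial support. [folklore] -/
theorem const_mul (h : ZSupp z₁ z₂ u) (c : ℝ) : ZSupp z₁ z₂ fun z θ => c * u z θ := fun z hz θ => by
  show c * u z θ = 0
  rw [h z hz θ, mul_zero]

end ZSupp

/-! ### Integrability on the strip of weighted products -/

/-- `w²` is continuous on `z > 0`. [folklore] -/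
theorem continuousOn_radialWeight_sq : ContinuousOn (fun z : ℝ => radialWeight z ^ 2) (Ioi 0) := by
  unfold radialWeight
  exact ContinuousOn.pow (ContinuousOn.div (by fun_prop) (by fun_prop) fun z hz => pow_ne_zero 2 (ne_of_gt hz)) 2

/-- **Integrability**: `w²·U·V·S^{−η}` is integrable on the strip for continuous plane functions `U`,
`V` with `U` radially supported in `[z₁, z₂]`, `z₁ > 0`. [folklore] -/
theorem integrableOn_strip_weight_mul_mul {U V : ℝ → ℝ → ℝ} (hU : Continuous (uncurry U)) (hV : Continuous (uncurry V))
    {z₁ z₂ : ℝ} (hz₁ : 0 < z₁) (hUz : ZSupp z₁ z₂ U) :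
    IntegrableOn (fun p : ℝ × ℝ => radialWeight p.1 ^ 2 * U p.1 p.2 * V p.1 p.2 * Real.sin (2 * p.2) ^ (-eta)) strip := by
  set H : ℝ × ℝ → ℝ := fun p => radialWeight p.1 ^ 2 * U p.1 p.2 * V p.1 p.2 with hH
  have hcont : ContinuousOn H (Set.Ioi 0 ×ˢ Set.univ) := by
    refine ((continuousOn_radialWeight_sq.comp continuous_fst.continuousOn fun p hp => hp.1).mul ?_).mul ?_
    · exact (hU.comp (continuous_fst.prodMk continuous_snd)).continuousOn
    · exact (hV.comp (continuous_fst.prodMk continuous_snd)).continuousOn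
  have hm : AEStronglyMeasurable H (volume.restrict strip) :=
    (hcont.mono fun p hp => ⟨hp.1, mem_univ _⟩).aestronglyMeasurable measurableSet_strip
  -- a bound on the compact box `[z₁, max z₁ z₂] × [0, π/2]`
  set Kbox : Set (ℝ × ℝ) := Icc z₁ (max z₁ z₂) ×ˢ Icc 0 (π / 2) with hK
  have hKc : IsCompact Kbox := isCompact_Icc.prod isCompact_Icc
  have hKsub : Kbox ⊆ Set.Ioi 0 ×ˢ Set.univ := fun p hp => ⟨lt_of_lt_of_le hz₁ hp.1.1, mem_univ _⟩
  obtain ⟨C, hC⟩ := hKc.exists_bound_of_continuousOn (hcont.mono hKsub)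
  have hbound : ∀ p ∈ strip, |H p| ≤ max C 0 := by
    intro p hp
    by_cases hz : z₁ ≤ p.1 ∧ p.1 ≤ z₂
    · have hmem : p ∈ Kbox := ⟨⟨hz.1, hz.2.trans (le_max_right _ _)⟩, ⟨hp.2.1.le, hp.2.2.le⟩⟩
      have := hC p hmem
      rw [Real.norm_eq_abs] at this
      exact this.trans (le_max_left _ _)
    · have hz' : p.1 < z₁ ∨ z₂ < p.1 := by
        rcases not_and_or.1 hz with h | h
        · exact Or.inl (not_le.1 h)
        · exact Or.inr (not_le.1 h)
      simp only [hH, hUz p.1 hz' p.2, mul_zero, zero_mul, abs_zero]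
      exact le_max_right _ _
  have hvan : ∀ p ∈ strip, z₂ < p.1 → H p = 0 := fun p _ hp => by
    simp only [hH, hUz p.1 (Or.inr hp) p.2, mul_zero, zero_mul]
  have h := integrableOn_strip_mul_rpow eta_pos.le (by norm_num [eta]) hm hbound hvan
  exact h.congr_fun (fun p _ => by simp only [hH]) measurableSet_strip

/-! ### Fubini on the strip for integrable functions, both orders -/

/-- The product structure of the strip measure (private copy). [folklore] -/
private theorem volume_restrict_strip_eq_prod₃ :
    (volume.restrict strip : Measure (ℝ × ℝ)) = (volume.restrict (Ioi (0:ℝ))).prod (volume.restrict (Ioo 0 (π / 2))) := by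
  rw [show strip = Ioi (0:ℝ) ×ˢ Ioo 0 (π / 2) from rfl, Measure.volume_eq_prod, Measure.prod_restrict]

/-- The inner `θ`-integral of a strip-integrable function is integrable in `z > 0`. [folklore] -/
theorem integrableOn_Ioi_integral_Ioo {G : ℝ × ℝ → ℝ} (hG : IntegrableOn G strip) :
    IntegrableOn (fun z => ∫ θ in Ioo 0 (π / 2), G (z, θ)) (Ioi 0) := by
  have h : Integrable G ((volume.restrict (Ioi (0:ℝ))).prod (volume.restrict (Ioo 0 (π / 2)))) := by
    rw [← volume_restrict_strip_eq_prod₃]; exact hG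
  exact h.integral_prod_left

/-- The inner `z`-integral of a strip-integrable function is integrable in `θ`. [folklore] -/
theorem integrableOn_Ioo_integral_Ioi {G : ℝ × ℝ → ℝ} (hG : IntegrableOn G strip) :
    IntegrableOn (fun θ => ∫ z in Ioi (0:ℝ), G (z, θ)) (Ioo 0 (π / 2)) := by
  have h : Integrable G ((volume.restrict (Ioi (0:ℝ))).prod (volume.restrict (Ioo 0 (π / 2)))) := by
    rw [← volume_restrict_strip_eq_prod₃]; exact hG
  exact h.swap.integral_prod_left

/-- `D_zΨ` is `Smooth2`. [folklore] -/
theorem Smooth2.smooth2_Dz {Ψ : ℝ → ℝ → ℝ} (hΨ : Smooth2 Ψ) : Smooth2 (Elgindi.Dz Ψ) := fun n => Smooth2.contDiff_iterate_Dz hΨ 1 n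

/-! ### The `𝓗⁴` assembly -/

/-- From an integrable nonnegative real integrand on the strip to `ℝ≥0∞`. [folklore] -/
theorem lintegral_strip_ofReal_eq {G : ℝ × ℝ → ℝ} (hG : IntegrableOn G strip) (hnn : ∀ p ∈ strip, 0 ≤ G p) :
    ∫⁻ p in strip, ENNReal.ofReal (G p) = ENNReal.ofReal (∫ p in strip, G p) :=
  (ofReal_integral_eq_lintegral_ofReal hG ((ae_restrict_iff' measurableSet_strip).2 (ae_of_all _ hnn))).symm

/-! ### The class: smooth, vanishing on the sides, radially supported in `(0, ∞)` -/

section Interp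

variable {Ψ : ℝ → ℝ → ℝ} (hΨ : Smooth2 Ψ) (h0 : ∀ z, Ψ z 0 = 0) (h1 : ∀ z, Ψ z (π / 2) = 0)
  {z₁ z₂ : ℝ} (hz₁ : 0 < z₁) (hKΨ : ZSupp z₁ z₂ Ψ)
include hΨ h0 h1 hz₁ hKΨ

set_option maxHeartbeats 1600000 in
/-- **The radial terms, real form**: for every `j`, with `Z = D_z^{j+1}Ψ`, `Z₂ = D_z^{j+2}Ψ`,
`B = D_zʲ∂_θθΨ` and the weight `w²S^{−η}` on the strip,
`α²∫∫(∂_θZ)² ≤ 600·(∫∫B² + α²∫∫Z² + α⁴∫∫Z₂²)` for `0 < α ≤ 1`. [folklore] -/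
theorem integral_strip_sq_dθ_Dz_le {α : ℝ} (hα : 0 < α) (hα1 : α ≤ 1) (j : ℕ) :
    IntegrableOn (fun p : ℝ × ℝ => radialWeight p.1 ^ 2 * dθ (Dz^[j + 1] Ψ) p.1 p.2 * dθ (Dz^[j + 1] Ψ) p.1 p.2 * Real.sin (2 * p.2) ^ (-eta)) strip ∧
    α ^ 2 * ∫ p in strip, radialWeight p.1 ^ 2 * dθ (Dz^[j + 1] Ψ) p.1 p.2 * dθ (Dz^[j + 1] Ψ) p.1 p.2 * Real.sin (2 * p.2) ^ (-eta) ≤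
      600 * ((∫ p in strip, radialWeight p.1 ^ 2 * (Dz^[j] (dθ (dθ Ψ))) p.1 p.2 * (Dz^[j] (dθ (dθ Ψ))) p.1 p.2 * Real.sin (2 * p.2) ^ (-eta)) +
        α ^ 2 * (∫ p in strip, radialWeight p.1 ^ 2 * (Dz^[j + 1] Ψ) p.1 p.2 * (Dz^[j + 1] Ψ) p.1 p.2 * Real.sin (2 * p.2) ^ (-eta)) +
        α ^ 4 * ∫ p in strip, radialWeight p.1 ^ 2 * (Dz^[j + 2] Ψ) p.1 p.2 * (Dz^[j + 2] Ψ) p.1 p.2 * Real.sin (2 * p.2) ^ (-eta)) := by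
  have hη1 : eta < 1 := by norm_num [eta]
  -- the players
  set W₀ : ℝ → ℝ → ℝ := Dz^[j] Ψ with hW₀
  set Z : ℝ → ℝ → ℝ := Dz^[j + 1] Ψ with hZ
  set Z₂ : ℝ → ℝ → ℝ := Dz^[j + 2] Ψ with hZ₂
  set b : ℝ → ℝ → ℝ := dθ (dθ W₀) with hb
  have eZ : Z = Elgindi.Dz W₀ := by rw [hZ, hW₀, Function.iterate_succ_apply']
  have eZ₂ : Z₂ = Elgindi.Dz Z := by rw [hZ₂, hZ, Function.iterate_succ_apply']
  have hW₀s : Smooth2 W₀ := fun n => Smooth2.contDiff_iterate_Dz hΨ j n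
  have hZs : Smooth2 Z := fun n => Smooth2.contDiff_iterate_Dz hΨ (j + 1) n
  have hZ₂s : Smooth2 Z₂ := fun n => Smooth2.contDiff_iterate_Dz hΨ (j + 2) n
  have hbs : Smooth2 b := Smooth2.smooth2_dθ (Smooth2.smooth2_dθ hW₀s)
  have hdZs : Smooth2 (dθ Z) := Smooth2.smooth2_dθ hZs
  have hddZs : Smooth2 (dθ (dθ Z)) := Smooth2.smooth2_dθ hdZs
  have hW₀z : ZSupp z₁ z₂ W₀ := hKΨ.iterate_Dz j
  have hZz : ZSupp z₁ z₂ Z := hKΨ.iterate_Dz (j + 1)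
  have hZ₂z : ZSupp z₁ z₂ Z₂ := hKΨ.iterate_Dz (j + 2)
  have hbz : ZSupp z₁ z₂ b := hW₀z.dθ.dθ
  have cont : ∀ {u : ℝ → ℝ → ℝ}, Smooth2 u → Continuous (uncurry u) := fun hu => (hu 0).continuous
  -- `∂_θθZ = D_z b` and `D_zʲ∂_θθΨ = b` on the strip
  have eDDZ : ∀ p ∈ strip, dθ (dθ Z) p.1 p.2 = Elgindi.Dz b p.1 p.2 := fun p hp => by
    rw [eZ]
    have h := Smooth2.dθ_dθ_iterate_Dz hW₀s 1 hp
    simpa only [Function.iterate_one] using h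
  have ebB : ∀ p ∈ strip, (Dz^[j] (dθ (dθ Ψ))) p.1 p.2 = b p.1 p.2 := fun p hp => (Smooth2.dθ_dθ_iterate_Dz hΨ j hp).symm
  -- integrability of everything
  have iI : IntegrableOn (fun p : ℝ × ℝ => radialWeight p.1 ^ 2 * dθ Z p.1 p.2 * dθ Z p.1 p.2 * Real.sin (2 * p.2) ^ (-eta)) strip :=
    integrableOn_strip_weight_mul_mul (cont hdZs) (cont hdZs) hz₁ hZz.dθ
  have iN : IntegrableOn (fun p : ℝ × ℝ => radialWeight p.1 ^ 2 * Z p.1 p.2 * dθ (dθ Z) p.1 p.2 * Real.sin (2 * p.2) ^ (-eta)) strip :=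
    integrableOn_strip_weight_mul_mul (cont hZs) (cont hddZs) hz₁ hZz
  have iB : IntegrableOn (fun p : ℝ × ℝ => radialWeight p.1 ^ 2 * b p.1 p.2 * b p.1 p.2 * Real.sin (2 * p.2) ^ (-eta)) strip :=
    integrableOn_strip_weight_mul_mul (cont hbs) (cont hbs) hz₁ hbz
  have iP₁ : IntegrableOn (fun p : ℝ × ℝ => radialWeight p.1 ^ 2 * Z p.1 p.2 * Z p.1 p.2 * Real.sin (2 * p.2) ^ (-eta)) strip :=
    integrableOn_strip_weight_mul_mul (cont hZs) (cont hZs) hz₁ hZz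
  have iP₂ : IntegrableOn (fun p : ℝ × ℝ => radialWeight p.1 ^ 2 * Z₂ p.1 p.2 * Z₂ p.1 p.2 * Real.sin (2 * p.2) ^ (-eta)) strip :=
    integrableOn_strip_weight_mul_mul (cont hZ₂s) (cont hZ₂s) hz₁ hZ₂z
  have ibZ : IntegrableOn (fun p : ℝ × ℝ => radialWeight p.1 ^ 2 * b p.1 p.2 * Z p.1 p.2 * Real.sin (2 * p.2) ^ (-eta)) strip :=
    integrableOn_strip_weight_mul_mul (cont hbs) (cont hZs) hz₁ hbz
  have ibZ₂ : IntegrableOn (fun p : ℝ × ℝ => radialWeight p.1 ^ 2 * b p.1 p.2 * Z₂ p.1 p.2 * Real.sin (2 * p.2) ^ (-eta)) strip :=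
    integrableOn_strip_weight_mul_mul (cont hbs) (cont hZ₂s) hz₁ hbz
  have hbabs : ZSupp z₁ z₂ (fun z θ => |b z θ|) := fun z hz θ => by
    show |b z θ| = 0
    rw [hbz z hz θ, abs_zero]
  have iabZ : IntegrableOn (fun p : ℝ × ℝ => radialWeight p.1 ^ 2 * |b p.1 p.2| * |Z p.1 p.2| * Real.sin (2 * p.2) ^ (-eta)) strip :=
    integrableOn_strip_weight_mul_mul (U := fun z θ => |b z θ|) (V := fun z θ => |Z z θ|)
      (continuous_abs.comp (cont hbs)) (continuous_abs.comp (cont hZs)) hz₁ hbabs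
  have iabZ₂ : IntegrableOn (fun p : ℝ × ℝ => radialWeight p.1 ^ 2 * |b p.1 p.2| * |Z₂ p.1 p.2| * Real.sin (2 * p.2) ^ (-eta)) strip :=
    integrableOn_strip_weight_mul_mul (U := fun z θ => |b z θ|) (V := fun z θ => |Z₂ z θ|)
      (continuous_abs.comp (cont hbs)) (continuous_abs.comp (cont hZ₂s)) hz₁ hbabs
  -- the weight derivative term: `b·Z·D_z(w²)·S^{−η}`, dominated by `4·w²|b||Z|S^{−η}`
  set DW : ℝ → ℝ := Dz₁ fun x => radialWeight x ^ 2 with hDW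
  have iG₂ : IntegrableOn (fun p : ℝ × ℝ => b p.1 p.2 * Z p.1 p.2 * DW p.1 * Real.sin (2 * p.2) ^ (-eta)) strip := by
    have hmeas : AEStronglyMeasurable (fun p : ℝ × ℝ => b p.1 p.2 * Z p.1 p.2 * DW p.1 * Real.sin (2 * p.2) ^ (-eta)) (volume.restrict strip) := by
      have hDWc : ContinuousOn DW (Ioi 0) := by
        have e : ∀ z ∈ Ioi (0:ℝ), DW z = -(4 * radialWeight z ^ 2 / (1 + z)) := fun z hz => Dz₁_radialWeight_sq hz
        refine ContinuousOn.congr ?_ e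
        refine ((continuousOn_const.mul continuousOn_radialWeight_sq).div (continuous_const.add continuous_id).continuousOn fun z hz => ?_).neg
        have : (0:ℝ) < z := hz
        exact ne_of_gt (by change (0:ℝ) < 1 + z; linarith)
      have hc : ContinuousOn (fun p : ℝ × ℝ => b p.1 p.2 * Z p.1 p.2 * DW p.1 * Real.sin (2 * p.2) ^ (-eta)) strip := by
        refine ContinuousOn.mul (ContinuousOn.mul ((cont hbs).continuousOn.mul (cont hZs).continuousOn)
          (hDWc.comp continuous_fst.continuousOn fun p hp => hp.1)) ?_
        exact ContinuousOn.rpow_const (by fun_prop) fun p hp => Or.inl (sin_two_mul_pos_of_mem hp.2).ne'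
      exact hc.aestronglyMeasurable measurableSet_strip
    refine Integrable.mono' (iabZ.const_mul 4) hmeas ?_
    rw [ae_restrict_iff' measurableSet_strip]
    refine Filter.Eventually.of_forall fun p hp => ?_
    have hu : 0 ≤ Real.sin (2 * p.2) ^ (-eta) := Real.rpow_nonneg (sin_two_mul_pos_of_mem hp.2).le _
    have hDW : |DW p.1| ≤ 4 * radialWeight p.1 ^ 2 := abs_Dz₁_radialWeight_sq_le hp.1
    rw [Real.norm_eq_abs, abs_mul, abs_of_nonneg hu, abs_mul, abs_mul]
    calc |b p.1 p.2| * |Z p.1 p.2| * |DW p.1| * Real.sin (2 * p.2) ^ (-eta)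
        ≤ |b p.1 p.2| * |Z p.1 p.2| * (4 * radialWeight p.1 ^ 2) * Real.sin (2 * p.2) ^ (-eta) := by gcongr
      _ = 4 * (radialWeight p.1 ^ 2 * |b p.1 p.2| * |Z p.1 p.2| * Real.sin (2 * p.2) ^ (-eta)) := by ring
  -- abbreviations for the real integrals
  set I₁ := ∫ p in strip, radialWeight p.1 ^ 2 * dθ Z p.1 p.2 * dθ Z p.1 p.2 * Real.sin (2 * p.2) ^ (-eta) with hI₁
  set N := ∫ p in strip, radialWeight p.1 ^ 2 * Z p.1 p.2 * dθ (dθ Z) p.1 p.2 * Real.sin (2 * p.2) ^ (-eta) with hN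
  set B := ∫ p in strip, radialWeight p.1 ^ 2 * b p.1 p.2 * b p.1 p.2 * Real.sin (2 * p.2) ^ (-eta) with hB
  set P₁ := ∫ p in strip, radialWeight p.1 ^ 2 * Z p.1 p.2 * Z p.1 p.2 * Real.sin (2 * p.2) ^ (-eta) with hP₁
  set P₂ := ∫ p in strip, radialWeight p.1 ^ 2 * Z₂ p.1 p.2 * Z₂ p.1 p.2 * Real.sin (2 * p.2) ^ (-eta) with hP₂
  set Q₁ := ∫ p in strip, radialWeight p.1 ^ 2 * |b p.1 p.2| * |Z p.1 p.2| * Real.sin (2 * p.2) ^ (-eta) with hQ₁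
  set Q₂ := ∫ p in strip, radialWeight p.1 ^ 2 * |b p.1 p.2| * |Z₂ p.1 p.2| * Real.sin (2 * p.2) ^ (-eta) with hQ₂
  have hB0 : 0 ≤ B := setIntegral_nonneg measurableSet_strip fun p hp =>
    mul_nonneg (by nlinarith [sq_nonneg (radialWeight p.1), sq_nonneg (b p.1 p.2)]) (Real.rpow_nonneg (sin_two_mul_pos_of_mem hp.2).le _)
  have hP₁0 : 0 ≤ P₁ := setIntegral_nonneg measurableSet_strip fun p hp =>
    mul_nonneg (by nlinarith [sq_nonneg (radialWeight p.1), sq_nonneg (Z p.1 p.2)]) (Real.rpow_nonneg (sin_two_mul_pos_of_mem hp.2).le _)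
  have hP₂0 : 0 ≤ P₂ := setIntegral_nonneg measurableSet_strip fun p hp =>
    mul_nonneg (by nlinarith [sq_nonneg (radialWeight p.1), sq_nonneg (Z₂ p.1 p.2)]) (Real.rpow_nonneg (sin_two_mul_pos_of_mem hp.2).le _)
  -- STEP 1 (angular identity, slice by slice): `I₁ ≤ 199·(−N)`
  have step1 : I₁ ≤ 199 * -N := by
    rw [hI₁, hN, integral_strip_eq_integral_Ioi_integral_Ioo' iI, integral_strip_eq_integral_Ioi_integral_Ioo' iN,
      ← MeasureTheory.integral_neg, ← MeasureTheory.integral_const_mul]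
    refine setIntegral_mono_on (integrableOn_Ioi_integral_Ioo iI) ?_ measurableSet_Ioi fun z hz => ?_
    · exact ((integrableOn_Ioi_integral_Ioo iN).neg).const_mul 199
    · have hz' : 0 < z := hz
      set Zs : ℝ → ℝ := fun θ => Z z θ with hZsdef
      have hZss : ContDiff ℝ ∞ Zs := Smooth2.contDiff_slice_iterate_Dz hΨ (j + 1) z
      have hZs0 : Zs 0 = 0 := iterate_Dz_apply_eq_zero h0 (j + 1) z
      have hZsp : Zs (π / 2) = 0 := iterate_Dz_apply_eq_zero h1 (j + 1) z
      obtain ⟨-, hθ⟩ := wsq_neg_eta_deriv_le_neg_integral hZss hZs0 hZsp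
      have e1 : wsq (-eta) (deriv Zs) = ∫ θ in Ioo 0 (π / 2), dθ Z z θ * dθ Z z θ * Real.sin (2 * θ) ^ (-eta) := by
        unfold wsq; refine setIntegral_congr_fun measurableSet_Ioo fun θ _ => ?_; simp only [hZsdef, Elgindi.dθ]; ring
      have e2 : ∫ θ in Ioo 0 (π / 2), Zs θ * deriv (deriv Zs) θ * Real.sin (2 * θ) ^ (-eta) =
          ∫ θ in Ioo 0 (π / 2), Z z θ * dθ (dθ Z) z θ * Real.sin (2 * θ) ^ (-eta) := by
        refine setIntegral_congr_fun measurableSet_Ioo fun θ _ => ?_; simp only [hZsdef, Elgindi.dθ]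
      rw [e1, e2] at hθ
      have hw : 0 ≤ radialWeight z ^ 2 := sq_nonneg _
      have eL : ∫ θ in Ioo 0 (π / 2), radialWeight z ^ 2 * dθ Z z θ * dθ Z z θ * Real.sin (2 * θ) ^ (-eta) =
          radialWeight z ^ 2 * ∫ θ in Ioo 0 (π / 2), dθ Z z θ * dθ Z z θ * Real.sin (2 * θ) ^ (-eta) := by
        rw [← MeasureTheory.integral_const_mul]; exact setIntegral_congr_fun measurableSet_Ioo fun θ _ => by ring
      have eR : ∫ θ in Ioo 0 (π / 2), radialWeight z ^ 2 * Z z θ * dθ (dθ Z) z θ * Real.sin (2 * θ) ^ (-eta) =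
          radialWeight z ^ 2 * ∫ θ in Ioo 0 (π / 2), Z z θ * dθ (dθ Z) z θ * Real.sin (2 * θ) ^ (-eta) := by
        rw [← MeasureTheory.integral_const_mul]; exact setIntegral_congr_fun measurableSet_Ioo fun θ _ => by ring
      simp only []
      rw [eL, eR]
      have h := mul_le_mul_of_nonneg_left hθ hw
      nlinarith [h]
  -- STEP 2 (radial identity, slice by slice): `−N = ∫∫ [b(Z + Z₂)w² + bZ·D_z(w²)]S^{−η}`
  have hW0 : ContDiffOn ℝ 0 (fun z : ℝ => radialWeight z ^ 2) (Ioi 0) := contDiffOn_zero.2 continuousOn_radialWeight_sq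
  have hslice : ∀ θ ∈ Ioo (0:ℝ) (π / 2),
      -(∫ z in Ioi (0:ℝ), radialWeight z ^ 2 * Z z θ * dθ (dθ Z) z θ * Real.sin (2 * θ) ^ (-eta)) =
        ((∫ z in Ioi (0:ℝ), radialWeight z ^ 2 * b z θ * Z z θ * Real.sin (2 * θ) ^ (-eta)) +
          ∫ z in Ioi (0:ℝ), radialWeight z ^ 2 * b z θ * Z₂ z θ * Real.sin (2 * θ) ^ (-eta)) +
        ∫ z in Ioi (0:ℝ), b z θ * Z z θ * DW z * Real.sin (2 * θ) ^ (-eta) := by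
    intro θ hθ
    -- the slice at `θ`
    set a : ℝ → ℝ := fun z => W₀ z θ with hadef
    set bθ : ℝ → ℝ := fun z => b z θ with hbθdef
    have has : ContDiff ℝ ∞ a := contDiff_infty.2 fun n => (hW₀s n).comp (contDiff_id.prodMk contDiff_const)
    have hbθs : ContDiff ℝ ∞ bθ := contDiff_infty.2 fun n => (hbs n).comp (contDiff_id.prodMk contDiff_const)
    have ha₁ : ∀ z < z₁, a z = 0 := fun z hz => hW₀z z (Or.inl hz) θ
    have ha₂ : ∀ z, z₂ < z → a z = 0 := fun z hz => hW₀z z (Or.inr hz) θ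
    have hid := integral_Ioi_Dz₁_mul_Dz₁_weight has hbθs hz₁ ha₁ ha₂
    -- identify the slices
    have sZ : ∀ z, Z z θ = Dz₁ a z := fun z => by rw [eZ]; rfl
    have sZ₂ : ∀ z, Z₂ z θ = Dz₁ (Dz₁ a) z := fun z => by
      rw [eZ₂]
      show z * deriv (fun z' => Z z' θ) z = z * deriv (Dz₁ a) z
      congr 1; congr 1; funext z'; exact sZ z'
    have sDDZ : ∀ z, 0 < z → dθ (dθ Z) z θ = Dz₁ bθ z := fun z hz => by
      rw [eDDZ (z, θ) ⟨hz, hθ⟩]; rfl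
    have eLHS : ∫ z in Ioi (0:ℝ), radialWeight z ^ 2 * Z z θ * dθ (dθ Z) z θ * Real.sin (2 * θ) ^ (-eta) =
        Real.sin (2 * θ) ^ (-eta) * ∫ z in Ioi (0:ℝ), Dz₁ a z * Dz₁ bθ z * radialWeight z ^ 2 := by
      rw [← MeasureTheory.integral_const_mul]
      refine setIntegral_congr_fun measurableSet_Ioi fun z hz => ?_
      rw [sZ z, sDDZ z hz]; ring
    have cb : Continuous fun z => b z θ := (cont hbs).comp (continuous_id.prodMk continuous_const)
    have sliceInt : ∀ {V : ℝ → ℝ → ℝ}, Smooth2 V → IntegrableOn (fun z => radialWeight z ^ 2 * b z θ * V z θ * Real.sin (2 * θ) ^ (-eta)) (Ioi 0) := by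
      intro V hVs
      have cV : Continuous fun z => V z θ := (cont hVs).comp (continuous_id.prodMk continuous_const)
      have hc : Continuous fun z => radialWeight z ^ 2 * (b z θ * V z θ) :=
        (contDiff_weight_mul (n := 0) hW0 (contDiff_zero.2 (cb.mul cV)) hz₁ (fun z hz => by simp [hbz z (Or.inl hz) θ])).continuous
      have hs : HasCompactSupport fun z => radialWeight z ^ 2 * (b z θ * V z θ) := by
        refine HasCompactSupport.intro (isCompact_Icc (a := z₁) (b := z₂)) fun z hz => ?_
        rcases not_and_or.1 (fun h => hz ⟨h.1, h.2⟩ : ¬(z₁ ≤ z ∧ z ≤ z₂)) with h | h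
        · simp [hbz z (Or.inl (not_le.1 h)) θ]
        · simp [hbz z (Or.inr (not_le.1 h)) θ]
      exact ((hc.integrable_of_hasCompactSupport hs).mul_const _).integrableOn.congr_fun (fun z _ => by ring) measurableSet_Ioi
    have iR1a := sliceInt hZs
    have iR1b := sliceInt hZ₂s
    have eR1 : (∫ z in Ioi (0:ℝ), radialWeight z ^ 2 * b z θ * Z z θ * Real.sin (2 * θ) ^ (-eta)) +
        (∫ z in Ioi (0:ℝ), radialWeight z ^ 2 * b z θ * Z₂ z θ * Real.sin (2 * θ) ^ (-eta)) =
        Real.sin (2 * θ) ^ (-eta) * ∫ z in Ioi (0:ℝ), bθ z * (Dz₁ a z + Dz₁ (Dz₁ a) z) * radialWeight z ^ 2 := by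
      rw [← MeasureTheory.integral_add iR1a iR1b, ← MeasureTheory.integral_const_mul]
      refine setIntegral_congr_fun measurableSet_Ioi fun z _ => ?_
      rw [sZ z, sZ₂ z]; simp only [hbθdef]; ring
    have eR2 : ∫ z in Ioi (0:ℝ), b z θ * Z z θ * DW z * Real.sin (2 * θ) ^ (-eta) =
        Real.sin (2 * θ) ^ (-eta) * ∫ z in Ioi (0:ℝ), bθ z * Dz₁ a z * DW z := by
      rw [← MeasureTheory.integral_const_mul]
      refine setIntegral_congr_fun measurableSet_Ioi fun z _ => ?_
      rw [sZ z]; simp only [hbθdef]; ring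
    rw [eLHS, eR1, eR2, hid]
    ring
  have step2 : -N = (∫ p in strip, radialWeight p.1 ^ 2 * b p.1 p.2 * Z p.1 p.2 * Real.sin (2 * p.2) ^ (-eta)) +
      (∫ p in strip, radialWeight p.1 ^ 2 * b p.1 p.2 * Z₂ p.1 p.2 * Real.sin (2 * p.2) ^ (-eta)) +
      ∫ p in strip, b p.1 p.2 * Z p.1 p.2 * DW p.1 * Real.sin (2 * p.2) ^ (-eta) := by
    have I1 : IntegrableOn (fun θ => ∫ z in Ioi (0:ℝ), radialWeight z ^ 2 * b z θ * Z z θ * Real.sin (2 * θ) ^ (-eta)) (Ioo 0 (π / 2)) :=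
      integrableOn_Ioo_integral_Ioi ibZ
    have I2 : IntegrableOn (fun θ => ∫ z in Ioi (0:ℝ), radialWeight z ^ 2 * b z θ * Z₂ z θ * Real.sin (2 * θ) ^ (-eta)) (Ioo 0 (π / 2)) :=
      integrableOn_Ioo_integral_Ioi ibZ₂
    have I3 : IntegrableOn (fun θ => ∫ z in Ioi (0:ℝ), b z θ * Z z θ * DW z * Real.sin (2 * θ) ^ (-eta)) (Ioo 0 (π / 2)) :=
      integrableOn_Ioo_integral_Ioi iG₂
    have I12 : IntegrableOn (fun θ => (∫ z in Ioi (0:ℝ), radialWeight z ^ 2 * b z θ * Z z θ * Real.sin (2 * θ) ^ (-eta)) +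
        ∫ z in Ioi (0:ℝ), radialWeight z ^ 2 * b z θ * Z₂ z θ * Real.sin (2 * θ) ^ (-eta)) (Ioo 0 (π / 2)) := I1.add I2
    rw [hN, integral_strip_eq_integral_Ioo_integral_Ioi' iN, integral_strip_eq_integral_Ioo_integral_Ioi' ibZ,
      integral_strip_eq_integral_Ioo_integral_Ioi' ibZ₂, integral_strip_eq_integral_Ioo_integral_Ioi' iG₂]
    dsimp only
    rw [← MeasureTheory.integral_neg, ← MeasureTheory.integral_add I1 I2, ← MeasureTheory.integral_add I12 I3]
    exact setIntegral_congr_fun measurableSet_Ioo fun θ hθ => hslice θ hθ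
  -- STEP 3 (Cauchy–Schwarz on the strip)
  have hw2 : ∀ p ∈ strip, Real.sqrt (radialWeight p.1 ^ 2 * Real.sin (2 * p.2) ^ (-eta)) ^ 2 = radialWeight p.1 ^ 2 * Real.sin (2 * p.2) ^ (-eta) :=
    fun p hp => Real.sq_sqrt (mul_nonneg (sq_nonneg _) (Real.rpow_nonneg (sin_two_mul_pos_of_mem hp.2).le _))
  have CS : ∀ {V : ℝ → ℝ → ℝ}, Smooth2 V → ZSupp z₁ z₂ V ∨ True →
      IntegrableOn (fun p : ℝ × ℝ => radialWeight p.1 ^ 2 * |b p.1 p.2| * |V p.1 p.2| * Real.sin (2 * p.2) ^ (-eta)) strip →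
      IntegrableOn (fun p : ℝ × ℝ => radialWeight p.1 ^ 2 * V p.1 p.2 * V p.1 p.2 * Real.sin (2 * p.2) ^ (-eta)) strip →
      (∫ p in strip, radialWeight p.1 ^ 2 * |b p.1 p.2| * |V p.1 p.2| * Real.sin (2 * p.2) ^ (-eta)) ^ 2 ≤
        B * ∫ p in strip, radialWeight p.1 ^ 2 * V p.1 p.2 * V p.1 p.2 * Real.sin (2 * p.2) ^ (-eta) := by
    intro V hVs _ iQ iP
    set φ : ℝ × ℝ → ℝ := fun p => |b p.1 p.2| * Real.sqrt (radialWeight p.1 ^ 2 * Real.sin (2 * p.2) ^ (-eta)) with hφ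
    set ψ : ℝ × ℝ → ℝ := fun p => |V p.1 p.2| * Real.sqrt (radialWeight p.1 ^ 2 * Real.sin (2 * p.2) ^ (-eta)) with hψ
    have eJ : (∫ p in strip, radialWeight p.1 ^ 2 * |b p.1 p.2| * |V p.1 p.2| * Real.sin (2 * p.2) ^ (-eta)) = ∫ p in strip, φ p * ψ p :=
      setIntegral_congr_fun measurableSet_strip fun p hp => by
        have e : φ p * ψ p = |b p.1 p.2| * |V p.1 p.2| * Real.sqrt (radialWeight p.1 ^ 2 * Real.sin (2 * p.2) ^ (-eta)) ^ 2 := by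
          simp only [hφ, hψ]; ring
        rw [e, hw2 p hp]; ring
    have eB : B = ∫ p in strip, φ p ^ 2 := setIntegral_congr_fun measurableSet_strip fun p hp => by
      simp only [hφ]; rw [mul_pow, hw2 p hp, sq_abs]; ring
    have eP : (∫ p in strip, radialWeight p.1 ^ 2 * V p.1 p.2 * V p.1 p.2 * Real.sin (2 * p.2) ^ (-eta)) = ∫ p in strip, ψ p ^ 2 :=
      setIntegral_congr_fun measurableSet_strip fun p hp => by
        simp only [hψ]; rw [mul_pow, hw2 p hp, sq_abs]; ring
    have iφ : IntegrableOn (fun p => φ p ^ 2) strip := iB.congr_fun (fun p hp => by simp only [hφ]; rw [mul_pow, hw2 p hp, sq_abs]; ring) measurableSet_strip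
    have iψ : IntegrableOn (fun p => ψ p ^ 2) strip := iP.congr_fun (fun p hp => by simp only [hψ]; rw [mul_pow, hw2 p hp, sq_abs]; ring) measurableSet_strip
    have iφψ : IntegrableOn (fun p => φ p * ψ p) strip := iQ.congr_fun (fun p hp => by
      have e : φ p * ψ p = |b p.1 p.2| * |V p.1 p.2| * Real.sqrt (radialWeight p.1 ^ 2 * Real.sin (2 * p.2) ^ (-eta)) ^ 2 := by
        simp only [hφ, hψ]; ring
      rw [e, hw2 p hp]; ring) measurableSet_strip
    rw [eJ, eB, eP]
    exact sq_integral_mul_le (μ := volume.restrict strip) iφ iψ iφψ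
  have CS₁ := CS hZs (Or.inl hZz) iabZ iP₁
  have CS₂ := CS hZ₂s (Or.inl hZ₂z) iabZ₂ iP₂
  -- bounds of the three terms of STEP 2 by `Q₁`, `Q₂`
  have bnd1 : |∫ p in strip, radialWeight p.1 ^ 2 * b p.1 p.2 * Z p.1 p.2 * Real.sin (2 * p.2) ^ (-eta)| ≤ Q₁ := by
    refine (abs_integral_le_integral_abs).trans (le_of_eq (setIntegral_congr_fun measurableSet_strip fun p hp => ?_))
    have hu : 0 ≤ Real.sin (2 * p.2) ^ (-eta) := Real.rpow_nonneg (sin_two_mul_pos_of_mem hp.2).le _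
    rw [abs_mul, abs_mul, abs_mul, abs_of_nonneg hu, abs_of_nonneg (sq_nonneg _)]
  have bnd2 : |∫ p in strip, radialWeight p.1 ^ 2 * b p.1 p.2 * Z₂ p.1 p.2 * Real.sin (2 * p.2) ^ (-eta)| ≤ Q₂ := by
    refine (abs_integral_le_integral_abs).trans (le_of_eq (setIntegral_congr_fun measurableSet_strip fun p hp => ?_))
    have hu : 0 ≤ Real.sin (2 * p.2) ^ (-eta) := Real.rpow_nonneg (sin_two_mul_pos_of_mem hp.2).le _
    rw [abs_mul, abs_mul, abs_mul, abs_of_nonneg hu, abs_of_nonneg (sq_nonneg _)]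
  have bnd3 : |∫ p in strip, b p.1 p.2 * Z p.1 p.2 * DW p.1 * Real.sin (2 * p.2) ^ (-eta)| ≤ 4 * Q₁ := by
    rw [hQ₁, ← MeasureTheory.integral_const_mul]
    refine (abs_integral_le_integral_abs).trans (setIntegral_mono_on iG₂.abs (iabZ.const_mul 4) measurableSet_strip fun p hp => ?_)
    have hu : 0 ≤ Real.sin (2 * p.2) ^ (-eta) := Real.rpow_nonneg (sin_two_mul_pos_of_mem hp.2).le _
    have hDWb : |DW p.1| ≤ 4 * radialWeight p.1 ^ 2 := abs_Dz₁_radialWeight_sq_le hp.1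
    rw [abs_mul, abs_mul, abs_mul, abs_of_nonneg hu]
    calc |b p.1 p.2| * |Z p.1 p.2| * |DW p.1| * Real.sin (2 * p.2) ^ (-eta)
        ≤ |b p.1 p.2| * |Z p.1 p.2| * (4 * radialWeight p.1 ^ 2) * Real.sin (2 * p.2) ^ (-eta) := by gcongr
      _ = 4 * (radialWeight p.1 ^ 2 * |b p.1 p.2| * |Z p.1 p.2| * Real.sin (2 * p.2) ^ (-eta)) := by ring
  -- STEP 4: the algebra
  have hQ₁0 : 0 ≤ Q₁ := setIntegral_nonneg measurableSet_strip fun p hp =>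
    mul_nonneg (mul_nonneg (mul_nonneg (sq_nonneg _) (abs_nonneg _)) (abs_nonneg _)) (Real.rpow_nonneg (sin_two_mul_pos_of_mem hp.2).le _)
  have hQ₂0 : 0 ≤ Q₂ := setIntegral_nonneg measurableSet_strip fun p hp =>
    mul_nonneg (mul_nonneg (mul_nonneg (sq_nonneg _) (abs_nonneg _)) (abs_nonneg _)) (Real.rpow_nonneg (sin_two_mul_pos_of_mem hp.2).le _)
  have hnegN : -N ≤ 5 * Q₁ + Q₂ := by
    rw [step2]
    linarith [le_abs_self (∫ p in strip, radialWeight p.1 ^ 2 * b p.1 p.2 * Z p.1 p.2 * Real.sin (2 * p.2) ^ (-eta)),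
      le_abs_self (∫ p in strip, radialWeight p.1 ^ 2 * b p.1 p.2 * Z₂ p.1 p.2 * Real.sin (2 * p.2) ^ (-eta)),
      le_abs_self (∫ p in strip, b p.1 p.2 * Z p.1 p.2 * DW p.1 * Real.sin (2 * p.2) ^ (-eta))]
  refine ⟨iI, ?_⟩
  -- `α²I₁ ≤ 199α²(5Q₁ + Q₂)`, `αQ₁ ≤ (B + α²P₁)/2`, `α²Q₂ ≤ (B + α⁴P₂)/2`
  have hα2 : 0 ≤ α ^ 2 := sq_nonneg α
  have hI : α ^ 2 * I₁ ≤ 199 * α ^ 2 * (5 * Q₁ + Q₂) := by nlinarith [step1, hnegN]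
  have k1 : (α * Q₁) ^ 2 ≤ B * (α ^ 2 * P₁) := by
    have h := mul_le_mul_of_nonneg_left CS₁ hα2
    have e1 : (α * Q₁) ^ 2 = α ^ 2 * Q₁ ^ 2 := by ring
    have e2 : B * (α ^ 2 * P₁) = α ^ 2 * (B * P₁) := by ring
    rw [e1, e2]; exact h
  have k2 : (α ^ 2 * Q₂) ^ 2 ≤ B * (α ^ 4 * P₂) := by
    have h := mul_le_mul_of_nonneg_left CS₂ (pow_nonneg hα.le 4)
    have e1 : (α ^ 2 * Q₂) ^ 2 = α ^ 4 * Q₂ ^ 2 := by ring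
    have e2 : B * (α ^ 4 * P₂) = α ^ 4 * (B * P₂) := by ring
    rw [e1, e2]; exact h
  have am1 : α * Q₁ ≤ (B + α ^ 2 * P₁) / 2 := by nlinarith [sq_nonneg (α * Q₁ - B), sq_nonneg (B - α ^ 2 * P₁), k1, hB0, mul_nonneg hα2 hP₁0]
  have am2 : α ^ 2 * Q₂ ≤ (B + α ^ 4 * P₂) / 2 := by
    nlinarith [sq_nonneg (α ^ 2 * Q₂ - B), sq_nonneg (B - α ^ 4 * P₂), k2, hB0, mul_nonneg (pow_nonneg hα.le 4) hP₂0]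
  have hαQ : α ^ 2 * Q₁ ≤ α * Q₁ := by nlinarith [mul_nonneg hα.le hQ₁0]
  have hI' : α ^ 2 * I₁ ≤ 995 * (α ^ 2 * Q₁) + 199 * (α ^ 2 * Q₂) := by
    linarith [hI, show (199:ℝ) * α ^ 2 * (5 * Q₁ + Q₂) = 995 * (α ^ 2 * Q₁) + 199 * (α ^ 2 * Q₂) by ring]
  have eBB : (∫ p in strip, radialWeight p.1 ^ 2 * (Dz^[j] (dθ (dθ Ψ))) p.1 p.2 * (Dz^[j] (dθ (dθ Ψ))) p.1 p.2 * Real.sin (2 * p.2) ^ (-eta)) = B :=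
    setIntegral_congr_fun measurableSet_strip fun p hp => by rw [ebB p hp]
  rw [eBB]
  linarith [hI', hαQ, am1, am2, mul_nonneg hα2 hP₁0, mul_nonneg (pow_nonneg hα.le 4) hP₂0]

/-! ### The `𝓗⁴` assembly -/

/-- **The radial terms in `eL2Sq` form**: for every `j`,
`‖D_zʲ(α∂_θD_zΨ)·w/s^{η/2}‖² ≤ 600(‖D_zʲ∂_θθΨ·…‖² + ‖D_zʲ(αD_zΨ)·…‖² + ‖D_zʲ(α²D_z²Ψ)·…‖²)`. [folklore] -/
theorem eL2Sq_hkRadialTerm_dθ_Dz_le {α : ℝ} (hα : 0 < α) (hα1 : α ≤ 1) (j : ℕ) :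
    eL2Sq (hkRadialTerm j fun z θ => α * dθ (Dz Ψ) z θ) ≤
      ENNReal.ofReal 600 * (eL2Sq (hkRadialTerm j (dθ (dθ Ψ))) + eL2Sq (hkRadialTerm j fun z θ => α * Dz Ψ z θ) +
        eL2Sq (hkRadialTerm j fun z θ => α ^ 2 * (Dz^[2] Ψ) z θ)) := by
  obtain ⟨iI, hle⟩ := integral_strip_sq_dθ_Dz_le hΨ h0 h1 hz₁ hKΨ hα hα1 j
  have cont : ∀ {u : ℝ → ℝ → ℝ}, Smooth2 u → Continuous (uncurry u) := fun hu => (hu 0).continuous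
  have hZs : Smooth2 (Dz^[j + 1] Ψ) := fun n => Smooth2.contDiff_iterate_Dz hΨ (j + 1) n
  have hZ₂s : Smooth2 (Dz^[j + 2] Ψ) := fun n => Smooth2.contDiff_iterate_Dz hΨ (j + 2) n
  have hdds : Smooth2 (dθ (dθ Ψ)) := Smooth2.smooth2_dθ (Smooth2.smooth2_dθ hΨ)
  have hBs : Smooth2 (Dz^[j] (dθ (dθ Ψ))) := fun n => Smooth2.contDiff_iterate_Dz hdds j n
  have iB : IntegrableOn (fun p : ℝ × ℝ => radialWeight p.1 ^ 2 * (Dz^[j] (dθ (dθ Ψ))) p.1 p.2 * (Dz^[j] (dθ (dθ Ψ))) p.1 p.2 * Real.sin (2 * p.2) ^ (-eta)) strip :=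
    integrableOn_strip_weight_mul_mul (cont hBs) (cont hBs) hz₁ ((hKΨ.dθ.dθ).iterate_Dz j)
  have iP₁ : IntegrableOn (fun p : ℝ × ℝ => radialWeight p.1 ^ 2 * (Dz^[j + 1] Ψ) p.1 p.2 * (Dz^[j + 1] Ψ) p.1 p.2 * Real.sin (2 * p.2) ^ (-eta)) strip :=
    integrableOn_strip_weight_mul_mul (cont hZs) (cont hZs) hz₁ (hKΨ.iterate_Dz (j + 1))
  have iP₂ : IntegrableOn (fun p : ℝ × ℝ => radialWeight p.1 ^ 2 * (Dz^[j + 2] Ψ) p.1 p.2 * (Dz^[j + 2] Ψ) p.1 p.2 * Real.sin (2 * p.2) ^ (-eta)) strip :=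
    integrableOn_strip_weight_mul_mul (cont hZ₂s) (cont hZ₂s) hz₁ (hKΨ.iterate_Dz (j + 2))
  -- the radial words of the four functions
  have eA : Dz^[j] (fun z θ => α * dθ (Dz Ψ) z θ) = fun z θ => α * (Dz^[j] (dθ (Dz Ψ))) z θ := iterate_Dz_theta_mul (fun _ => α) _ j
  have eAstrip : ∀ p ∈ strip, (Dz^[j] (dθ (Dz Ψ))) p.1 p.2 = dθ (Dz^[j + 1] Ψ) p.1 p.2 := fun p hp => by
    rw [← Smooth2.dθ_iterate_Dz (hΨ.smooth2_Dz) j hp]; rfl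
  have eP₁ : Dz^[j] (fun z θ => α * Dz Ψ z θ) = fun z θ => α * (Dz^[j + 1] Ψ) z θ := by
    rw [iterate_Dz_theta_mul (fun _ => α) _ j]; rfl
  have eP₂ : Dz^[j] (fun z θ => α ^ 2 * (Dz^[2] Ψ) z θ) = fun z θ => α ^ 2 * (Dz^[j + 2] Ψ) z θ := by
    rw [iterate_Dz_theta_mul (fun _ => α ^ 2) _ j]
    funext z θ; rw [← Function.iterate_add_apply]
  have nn : ∀ (x : ℝ) {p : ℝ × ℝ}, p ∈ strip → 0 ≤ radialWeight p.1 ^ 2 * x * x * Real.sin (2 * p.2) ^ (-eta) := fun x p hp => by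
    have : 0 ≤ Real.sin (2 * p.2) ^ (-eta) := Real.rpow_nonneg (sin_two_mul_pos_of_mem hp.2).le _
    nlinarith [mul_nonneg (mul_nonneg (sq_nonneg (radialWeight p.1)) (mul_self_nonneg x)) this]
  -- the four `eL2Sq` in real form
  have L : eL2Sq (hkRadialTerm j fun z θ => α * dθ (Dz Ψ) z θ) =
      ENNReal.ofReal (α ^ 2 * ∫ p in strip, radialWeight p.1 ^ 2 * dθ (Dz^[j + 1] Ψ) p.1 p.2 * dθ (Dz^[j + 1] Ψ) p.1 p.2 * Real.sin (2 * p.2) ^ (-eta)) := by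
    rw [eL2Sq_eq_lintegral_ofReal, ← MeasureTheory.integral_const_mul, ← lintegral_strip_ofReal_eq (iI.const_mul _) (fun p hp => mul_nonneg (sq_nonneg α) (nn _ hp))]
    refine setLIntegral_congr_fun measurableSet_strip fun p hp => ?_
    rw [sq_hkRadialTerm j _ hp, eA]; simp only [eAstrip p hp]; congr 1; ring
  have RB : eL2Sq (hkRadialTerm j (dθ (dθ Ψ))) =
      ENNReal.ofReal (∫ p in strip, radialWeight p.1 ^ 2 * (Dz^[j] (dθ (dθ Ψ))) p.1 p.2 * (Dz^[j] (dθ (dθ Ψ))) p.1 p.2 * Real.sin (2 * p.2) ^ (-eta)) := by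
    rw [eL2Sq_eq_lintegral_ofReal, ← lintegral_strip_ofReal_eq iB (fun p hp => nn _ hp)]
    refine setLIntegral_congr_fun measurableSet_strip fun p hp => ?_
    rw [sq_hkRadialTerm j _ hp]; congr 1; ring
  have RP₁ : eL2Sq (hkRadialTerm j fun z θ => α * Dz Ψ z θ) =
      ENNReal.ofReal (α ^ 2 * ∫ p in strip, radialWeight p.1 ^ 2 * (Dz^[j + 1] Ψ) p.1 p.2 * (Dz^[j + 1] Ψ) p.1 p.2 * Real.sin (2 * p.2) ^ (-eta)) := by
    rw [eL2Sq_eq_lintegral_ofReal, ← MeasureTheory.integral_const_mul, ← lintegral_strip_ofReal_eq (iP₁.const_mul _) (fun p hp => mul_nonneg (sq_nonneg α) (nn _ hp))]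
    refine setLIntegral_congr_fun measurableSet_strip fun p hp => ?_
    rw [sq_hkRadialTerm j _ hp, eP₁]; congr 1; ring
  have RP₂ : eL2Sq (hkRadialTerm j fun z θ => α ^ 2 * (Dz^[2] Ψ) z θ) =
      ENNReal.ofReal (α ^ 4 * ∫ p in strip, radialWeight p.1 ^ 2 * (Dz^[j + 2] Ψ) p.1 p.2 * (Dz^[j + 2] Ψ) p.1 p.2 * Real.sin (2 * p.2) ^ (-eta)) := by
    rw [eL2Sq_eq_lintegral_ofReal, ← MeasureTheory.integral_const_mul, ← lintegral_strip_ofReal_eq (iP₂.const_mul _) (fun p hp => mul_nonneg (pow_nonneg hα.le 4) (nn _ hp))]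
    refine setLIntegral_congr_fun measurableSet_strip fun p hp => ?_
    rw [sq_hkRadialTerm j _ hp, eP₂]; congr 1; ring
  have hB0 : 0 ≤ ∫ p in strip, radialWeight p.1 ^ 2 * (Dz^[j] (dθ (dθ Ψ))) p.1 p.2 * (Dz^[j] (dθ (dθ Ψ))) p.1 p.2 * Real.sin (2 * p.2) ^ (-eta) :=
    setIntegral_nonneg measurableSet_strip fun p hp => nn _ hp
  have hP₁0 : 0 ≤ α ^ 2 * ∫ p in strip, radialWeight p.1 ^ 2 * (Dz^[j + 1] Ψ) p.1 p.2 * (Dz^[j + 1] Ψ) p.1 p.2 * Real.sin (2 * p.2) ^ (-eta) :=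
    mul_nonneg (sq_nonneg α) (setIntegral_nonneg measurableSet_strip fun p hp => nn _ hp)
  have hP₂0 : 0 ≤ α ^ 4 * ∫ p in strip, radialWeight p.1 ^ 2 * (Dz^[j + 2] Ψ) p.1 p.2 * (Dz^[j + 2] Ψ) p.1 p.2 * Real.sin (2 * p.2) ^ (-eta) :=
    mul_nonneg (pow_nonneg hα.le 4) (setIntegral_nonneg measurableSet_strip fun p hp => nn _ hp)
  rw [L, RB, RP₁, RP₂, ← ENNReal.ofReal_add hB0 hP₁0, ← ENNReal.ofReal_add (add_nonneg hB0 hP₁0) hP₂0, ← ENNReal.ofReal_mul (by norm_num)]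
  exact ENNReal.ofReal_le_ofReal hle

omit h0 h1 hz₁ hKΨ in
/-- **The angular words**: for `1 ≤ i`, `i ≤ 4` and any `j`,
`‖D_θⁱD_zʲ(α∂_θD_zΨ)·W‖² ≤ 4·10⁹·(Σ_{l<i−1} ‖D_θ^{l+1}D_z^{j+1}∂_θθΨ·W‖² + ‖D_z^{j+1}∂_θθΨ·w/s^{η/2}‖²)`
(`0 < α ≤ 1`). [folklore] -/
theorem eL2Sq_hkMixedTerm_dθ_Dz_le {α : ℝ} (hα : 0 < α) (hα1 : α ≤ 1) {i : ℕ} (hi1 : 1 ≤ i) (hi4 : i ≤ 4) (j : ℕ) :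
    eL2Sq (hkMixedTerm α i j fun z θ => α * dθ (Dz Ψ) z θ) ≤
      ENNReal.ofReal (4 * 10 ^ 9) * ((∑ l ∈ Finset.range (i - 1), eL2Sq (hkMixedTerm α (l + 1) (j + 1) (dθ (dθ Ψ)))) +
        eL2Sq (hkRadialTerm (j + 1) (dθ (dθ Ψ)))) := by
  set γ := gammaExp α with hγ
  have hγ1 : 1 < γ := by rw [hγ]; unfold gammaExp; linarith
  have hγ2 : γ < 2 := by rw [hγ]; unfold gammaExp; linarith
  obtain ⟨m, rfl⟩ : ∃ m, i = m + 1 := ⟨i - 1, by omega⟩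
  have hm : m ≤ 3 := by omega
  rw [show m + 1 - 1 = m by omega]
  set Fα : ℝ → ℝ → ℝ := fun z θ => α * dθ (Dz Ψ) z θ with hFα
  have hdds : Smooth2 (dθ (dθ Ψ)) := Smooth2.smooth2_dθ (Smooth2.smooth2_dθ hΨ)
  have hFαs : Smooth2 Fα := by
    intro n
    have h := Smooth2.smooth2_dθ (hΨ.smooth2_Dz) n
    exact contDiff_const.mul h
  -- measurability
  have mA : AEMeasurable (fun p : ℝ × ℝ => ENNReal.ofReal ((hkMixedTerm α (m + 1) j Fα p.1 p.2) ^ 2)) (volume.restrict strip) :=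
    ((aemeasurable_hkMixedTerm_strip α (Smooth2.contDiffOn_strip hFαs (m + 1 + j)) le_rfl).pow_const 2).ennreal_ofReal
  have mB : ∀ l, AEMeasurable (fun p : ℝ × ℝ => ENNReal.ofReal ((hkMixedTerm α (l + 1) (j + 1) (dθ (dθ Ψ)) p.1 p.2) ^ 2)) (volume.restrict strip) := fun l =>
    ((aemeasurable_hkMixedTerm_strip α (Smooth2.contDiffOn_strip hdds (l + 1 + (j + 1))) le_rfl).pow_const 2).ennreal_ofReal
  have mR : AEMeasurable (fun p : ℝ × ℝ => ENNReal.ofReal ((hkRadialTerm (j + 1) (dθ (dθ Ψ)) p.1 p.2) ^ 2)) (volume.restrict strip) :=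
    ((aemeasurable_hkRadialTerm_strip (Smooth2.contDiffOn_strip hdds (j + 1)) le_rfl).pow_const 2).ennreal_ofReal
  have LA : eL2Sq (hkMixedTerm α (m + 1) j Fα) = ∫⁻ z in Ioi 0, ∫⁻ θ in Ioo 0 (π / 2), ENNReal.ofReal ((hkMixedTerm α (m + 1) j Fα z θ) ^ 2) := by
    rw [eL2Sq_eq_lintegral_ofReal, lintegral_strip_eq_radial_theta_ae mA]
  have LB : ∀ l, eL2Sq (hkMixedTerm α (l + 1) (j + 1) (dθ (dθ Ψ))) = ∫⁻ z in Ioi 0, ∫⁻ θ in Ioo 0 (π / 2), ENNReal.ofReal ((hkMixedTerm α (l + 1) (j + 1) (dθ (dθ Ψ)) z θ) ^ 2) :=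
    fun l => by rw [eL2Sq_eq_lintegral_ofReal, lintegral_strip_eq_radial_theta_ae (mB l)]
  have LR : eL2Sq (hkRadialTerm (j + 1) (dθ (dθ Ψ))) = ∫⁻ z in Ioi 0, ∫⁻ θ in Ioo 0 (π / 2), ENNReal.ofReal ((hkRadialTerm (j + 1) (dθ (dθ Ψ)) z θ) ^ 2) := by
    rw [eL2Sq_eq_lintegral_ofReal, lintegral_strip_eq_radial_theta_ae mR]
  simp only [LB]
  rw [LA, LR, ← lintegral_finsetSum' _ (fun l _ => aemeasurable_lintegral_slice (mB l)),
    ← lintegral_add_left' (Finset.aemeasurable_fun_sum _ fun l _ => aemeasurable_lintegral_slice (mB l)),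
    ← lintegral_const_mul' _ _ ENNReal.ofReal_ne_top]
  refine setLIntegral_mono' measurableSet_Ioi fun z hz => ?_
  have hz' : 0 < z := hz
  -- the slice: `u = D_z^{j+1}Ψ(z,·)`, `v = (D_z^{j+1}∂_θθΨ)(z,·) = u″` on `(0, π/2)`
  set u : ℝ → ℝ := fun θ => (Dz^[j + 1] Ψ) z θ with hu
  set v : ℝ → ℝ := fun θ => (Dz^[j + 1] (dθ (dθ Ψ))) z θ with hv
  have hus : ContDiff ℝ ∞ u := Smooth2.contDiff_slice_iterate_Dz hΨ (j + 1) z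
  have hvs : ContDiff ℝ ∞ v := Smooth2.contDiff_slice_iterate_Dz hdds (j + 1) z
  have hvu : ∀ θ ∈ Ioo (0:ℝ) (π / 2), deriv (deriv u) θ = v θ := fun θ hθ =>
    Smooth2.dθ_dθ_iterate_Dz hΨ (j + 1) (p := (z, θ)) ⟨hz', hθ⟩
  -- the word of `Fα` at the slice
  have eA : Dz^[j] Fα = fun z θ => α * (Dz^[j] (dθ (Dz Ψ))) z θ := iterate_Dz_theta_mul (fun _ => α) _ j
  have eslice : ∀ θ ∈ Ioo (0:ℝ) (π / 2), (Dz^[j] Fα) z θ = α * deriv u θ := fun θ hθ => by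
    rw [eA]; simp only []
    rw [← Smooth2.dθ_iterate_Dz (hΨ.smooth2_Dz) j (p := (z, θ)) ⟨hz', hθ⟩]; rfl
  have eword : ∀ θ ∈ Ioo (0:ℝ) (π / 2), (Dθ^[m + 1] (Dz^[j] Fα)) z θ = α * (Dθ₁^[m] fun x => Real.sin (2 * x) * deriv (deriv u) x) θ := by
    intro θ hθ
    rw [iterate_Dθ_apply, iterate_Dθ₁_congr_of_Ioo eslice (m + 1) θ hθ, iterate_Dθ₁_const_mul, Function.iterate_succ_apply]
    rfl
  have ewordv : ∀ θ ∈ Ioo (0:ℝ) (π / 2), (Dθ^[m + 1] (Dz^[j] Fα)) z θ = α * (Dθ₁^[m] fun x => Real.sin (2 * x) * v x) θ := by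
    intro θ hθ
    rw [eword θ hθ, iterate_Dθ₁_congr_of_Ioo (g := fun x => Real.sin (2 * x) * deriv (deriv u) x) (h := fun x => Real.sin (2 * x) * v x)
      (fun x hx => by rw [hvu x hx]) m θ hθ]
  -- the words lemma for `v`
  obtain ⟨iW, hW⟩ := wsq_iterate_Dθ₁_sin_mul_le hγ1 hγ2 hvs hm
  obtain ⟨iv, -⟩ := wsq_iterate_Dθ₁_le hγ2 hvs
  have ivR : IntegrableOn (fun θ => v θ ^ 2 * Real.sin (2 * θ) ^ (-eta)) (Ioo 0 (π / 2)) := integrableOn_sq_mul_sin_rpow_neg_eta hvs.continuous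
  have hw : 0 ≤ radialWeight z ^ 2 := sq_nonneg _
  set A : ℕ → ℝ → ℝ := fun _ θ => radialWeight z ^ 2 * ((α * (Dθ₁^[m] fun x => Real.sin (2 * x) * v x) θ) ^ 2 * Real.sin (2 * θ) ^ (-γ)) with hA
  set B : ℕ → ℝ → ℝ := fun l θ => radialWeight z ^ 2 * ((Dθ₁^[l + 1] v) θ ^ 2 * Real.sin (2 * θ) ^ (-γ)) with hB
  set B₀ : ℝ → ℝ := fun θ => radialWeight z ^ 2 * (v θ ^ 2 * Real.sin (2 * θ) ^ (-eta)) with hB₀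
  have eLA : ∀ θ ∈ Ioo (0:ℝ) (π / 2), ENNReal.ofReal ((hkMixedTerm α (m + 1) j Fα z θ) ^ 2) = ENNReal.ofReal (A 0 θ) := fun θ hθ => by
    rw [sq_hkMixedTerm α (m + 1) j Fα (p := (z, θ)) ⟨hz', hθ⟩]
    simp only [hA]; rw [ewordv θ hθ]; congr 1; ring
  have eLB : ∀ l, ∀ θ ∈ Ioo (0:ℝ) (π / 2), ENNReal.ofReal ((hkMixedTerm α (l + 1) (j + 1) (dθ (dθ Ψ)) z θ) ^ 2) = ENNReal.ofReal (B l θ) := fun l θ hθ => by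
    rw [sq_hkMixedTerm α (l + 1) (j + 1) (dθ (dθ Ψ)) (p := (z, θ)) ⟨hz', hθ⟩]
    simp only [iterate_Dθ_apply, hB]; congr 1; ring
  have eLR : ∀ θ ∈ Ioo (0:ℝ) (π / 2), ENNReal.ofReal ((hkRadialTerm (j + 1) (dθ (dθ Ψ)) z θ) ^ 2) = ENNReal.ofReal (B₀ θ) := fun θ hθ => by
    rw [sq_hkRadialTerm (j + 1) (dθ (dθ Ψ)) (p := (z, θ)) ⟨hz', hθ⟩]
    simp only [hB₀]; congr 1; ring
  have eL1 : ∫⁻ θ in Ioo 0 (π / 2), ENNReal.ofReal ((hkMixedTerm α (m + 1) j Fα z θ) ^ 2) = ∑ i ∈ Finset.range 1, ∫⁻ θ in Ioo 0 (π / 2), ENNReal.ofReal (A i θ) := by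
    rw [Finset.sum_range_one, setLIntegral_congr_fun measurableSet_Ioo eLA]
  rw [eL1, Finset.sum_congr rfl fun l _ => setLIntegral_congr_fun measurableSet_Ioo (eLB l), setLIntegral_congr_fun measurableSet_Ioo eLR]
  -- the real inequality
  have hα2 : α ^ 2 ≤ 1 := by nlinarith
  have hle' : (∑ i ∈ Finset.range 1, ∫ θ in Ioo 0 (π / 2), A i θ) ≤
      4 * 10 ^ 9 * ((∑ l ∈ Finset.range m, ∫ θ in Ioo 0 (π / 2), B l θ) + ∫ θ in Ioo 0 (π / 2), B₀ θ) := by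
    rw [Finset.sum_range_one]
    simp only [hA, hB, hB₀, MeasureTheory.integral_const_mul, ← Finset.mul_sum]
    have hW' : (∫ θ in Ioo 0 (π / 2), (α * (Dθ₁^[m] fun x => Real.sin (2 * x) * v x) θ) ^ 2 * Real.sin (2 * θ) ^ (-γ)) ≤
        wsq (-γ) (Dθ₁^[m] fun x => Real.sin (2 * x) * v x) := by
      unfold wsq
      refine setIntegral_mono_on ?_ iW measurableSet_Ioo fun θ hθ => ?_
      · exact IntegrableOn.congr_fun (iW.const_mul (α ^ 2)) (fun θ _ => by ring) measurableSet_Ioo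
      · have hs0 : 0 ≤ Real.sin (2 * θ) ^ (-γ) := Real.rpow_nonneg (sin_two_mul_pos_of_mem hθ).le _
        have hsq : 0 ≤ (Dθ₁^[m] fun x => Real.sin (2 * x) * v x) θ ^ 2 * Real.sin (2 * θ) ^ (-γ) := mul_nonneg (sq_nonneg _) hs0
        nlinarith
    have h := mul_le_mul_of_nonneg_left (hW'.trans hW) hw
    have n0 := wsq_nonneg (-eta) v
    have e : radialWeight z ^ 2 * (4 * 10 ^ 9 * ((∑ i ∈ Finset.range m, wsq (-γ) (Dθ₁^[i + 1] v)) + wsq (-eta) v)) =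
        4 * 10 ^ 9 * (radialWeight z ^ 2 * (∑ i ∈ Finset.range m, wsq (-γ) (Dθ₁^[i + 1] v)) + radialWeight z ^ 2 * wsq (-eta) v) := by ring
    simp only [wsq] at h e
    linarith
  have nn : ∀ (x : ℝ) {θ : ℝ}, θ ∈ Ioo (0:ℝ) (π / 2) → ∀ q : ℝ, 0 ≤ radialWeight z ^ 2 * (x ^ 2 * Real.sin (2 * θ) ^ q) := fun x θ hθ q =>
    mul_nonneg hw (mul_nonneg (sq_nonneg _) (Real.rpow_nonneg (sin_two_mul_pos_of_mem hθ).le _))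
  exact sum_lintegral_ofReal_le_of_integral_le' (n := 1) (m := m)
    (fun i _ => IntegrableOn.congr_fun (iW.const_mul (radialWeight z ^ 2 * α ^ 2)) (fun θ _ => by ring) measurableSet_Ioo)
    (fun l hl => (iv (l + 1) (by omega) (by omega)).const_mul _) (ivR.const_mul _)
    (fun i _ θ hθ => nn _ hθ _) (fun l _ θ hθ => nn _ hθ _) (fun θ hθ => nn _ hθ _) (by norm_num) hle'

/-- **The mixed derivative in `𝓗⁴` by interpolation**: for `Ψ` smooth on `ℝ²`, vanishing on the sides
`θ = 0, π/2` and radially supported in `[z₁, z₂] ⊂ (0, ∞)`, and `0 < α ≤ 1`,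
`|α∂_θD_zΨ|²_{𝓗⁴} ≤ 10¹²·(|∂_θθΨ|²_{𝓗⁴} + |αD_zΨ|²_{𝓗⁴} + |α²D_z²Ψ|²_{𝓗⁴})` (`eHkNormSq α 4`). [folklore] -/
theorem eHkNormSq_dθ_Dz_le {α : ℝ} (hα : 0 < α) (hα1 : α ≤ 1) :
    eHkNormSq α 4 (fun z θ => α * dθ (Dz Ψ) z θ) ≤
      ENNReal.ofReal (10 ^ 12) * (eHkNormSq α 4 (dθ (dθ Ψ)) + eHkNormSq α 4 (fun z θ => α * Dz Ψ z θ) +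
        eHkNormSq α 4 (fun z θ => α ^ 2 * (Dz^[2] Ψ) z θ)) := by
  set E₁ := eHkNormSq α 4 (dθ (dθ Ψ)) with hE₁
  set E₂ := eHkNormSq α 4 (fun z θ => α * Dz Ψ z θ) with hE₂
  set E₃ := eHkNormSq α 4 (fun z θ => α ^ 2 * (Dz^[2] Ψ) z θ) with hE₃
  have hB := eHkNormSq_le_of_forall_le (α := α) (k := 4) (f := fun z θ => α * dθ (Dz Ψ) z θ) (B := ENNReal.ofReal (2 * 10 ^ 10) * (E₁ + E₂ + E₃))
    (fun j hj => by
      refine (eL2Sq_hkRadialTerm_dθ_Dz_le hΨ h0 h1 hz₁ hKΨ hα hα1 j).trans ?_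
      have h3 : eL2Sq (hkRadialTerm j (dθ (dθ Ψ))) + eL2Sq (hkRadialTerm j fun z θ => α * Dz Ψ z θ) +
          eL2Sq (hkRadialTerm j fun z θ => α ^ 2 * (Dz^[2] Ψ) z θ) ≤ E₁ + E₂ + E₃ :=
        add_le_add (add_le_add (eL2Sq_hkRadialTerm_le α hj _) (eL2Sq_hkRadialTerm_le α hj _)) (eL2Sq_hkRadialTerm_le α hj _)
      calc ENNReal.ofReal 600 * (eL2Sq (hkRadialTerm j (dθ (dθ Ψ))) + eL2Sq (hkRadialTerm j fun z θ => α * Dz Ψ z θ) +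
            eL2Sq (hkRadialTerm j fun z θ => α ^ 2 * (Dz^[2] Ψ) z θ)) ≤ ENNReal.ofReal 600 * (E₁ + E₂ + E₃) := by gcongr
        _ ≤ ENNReal.ofReal (2 * 10 ^ 10) * (E₁ + E₂ + E₃) := by gcongr; norm_num)
    (fun i j hi hij => by
      refine (eL2Sq_hkMixedTerm_dθ_Dz_le hΨ hα hα1 hi (by omega) j).trans ?_
      have h5 : (∑ l ∈ Finset.range (i - 1), eL2Sq (hkMixedTerm α (l + 1) (j + 1) (dθ (dθ Ψ)))) + eL2Sq (hkRadialTerm (j + 1) (dθ (dθ Ψ))) ≤ 5 * E₁ := by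
        have hsum : (∑ l ∈ Finset.range (i - 1), eL2Sq (hkMixedTerm α (l + 1) (j + 1) (dθ (dθ Ψ)))) ≤ 4 * E₁ := by
          have h1' : ∀ l ∈ Finset.range (i - 1), eL2Sq (hkMixedTerm α (l + 1) (j + 1) (dθ (dθ Ψ))) ≤ E₁ := fun l hl =>
            eL2Sq_hkMixedTerm_le α (by omega) (by have := Finset.mem_range.1 hl; omega) _
          calc (∑ l ∈ Finset.range (i - 1), eL2Sq (hkMixedTerm α (l + 1) (j + 1) (dθ (dθ Ψ)))) ≤ ∑ _l ∈ Finset.range (i - 1), E₁ := Finset.sum_le_sum h1'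
            _ = ((i - 1 : ℕ) : ℝ≥0∞) * E₁ := by rw [Finset.sum_const, Finset.card_range, nsmul_eq_mul]
            _ ≤ 4 * E₁ := by gcongr; exact_mod_cast (by omega : i - 1 ≤ 4)
        have hr : eL2Sq (hkRadialTerm (j + 1) (dθ (dθ Ψ))) ≤ E₁ := eL2Sq_hkRadialTerm_le α (by omega) _
        calc (∑ l ∈ Finset.range (i - 1), eL2Sq (hkMixedTerm α (l + 1) (j + 1) (dθ (dθ Ψ)))) + eL2Sq (hkRadialTerm (j + 1) (dθ (dθ Ψ))) ≤ 4 * E₁ + E₁ :=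
            add_le_add hsum hr
          _ = 5 * E₁ := by ring
      calc ENNReal.ofReal (4 * 10 ^ 9) * ((∑ l ∈ Finset.range (i - 1), eL2Sq (hkMixedTerm α (l + 1) (j + 1) (dθ (dθ Ψ)))) + eL2Sq (hkRadialTerm (j + 1) (dθ (dθ Ψ))))
          ≤ ENNReal.ofReal (4 * 10 ^ 9) * (5 * E₁) := by gcongr
        _ = ENNReal.ofReal (2 * 10 ^ 10) * E₁ := by
            rw [← mul_assoc, show (5 : ℝ≥0∞) = ENNReal.ofReal 5 by norm_num, ← ENNReal.ofReal_mul (by norm_num)]; norm_num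
        _ ≤ ENNReal.ofReal (2 * 10 ^ 10) * (E₁ + E₂ + E₃) := by gcongr; exact le_add_right le_rfl |>.trans (le_add_right le_rfl))
  refine hB.trans ?_
  rw [← mul_assoc]
  gcongr
  rw [show (((4 + 1) + (4 + 1) ^ 2 : ℕ) : ℝ≥0∞) = ENNReal.ofReal 30 by norm_num, ← ENNReal.ofReal_mul (by norm_num)]
  exact ENNReal.ofReal_le_ofReal (by norm_num)

end Interp

end Elgindi

end Literature.Analysis.FluidPDE
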